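import Summits.HodgeConjecture.HodgeConjecture.Theorems.R90S4EpsClassesOverNormFinite   -- ★ p863871 (K2E3-p27 g3) (FIN) hypothesis-first over (K-FIN): `epsNorm_eq_one_of_mem_normFibre`, `epsNorm_mul_eq_coe_of_epsNorm_eq_one`, `finite_setOf_isStablyEpsConjAt_of_normCosetsFinite`, `ncard_setOf_isStablyEpsConjAt_eq_card`; brings ★ α p863634 `R90S4TwistedCartanNormFibres` (`setOf_isStablyEpsConjAt_out_eq_image_normFibre`, `epsConjClassesMod_mk_eq_mk_iff`, `isEpsConj_iff_exists_mem_centralizer_of_epsNorm_eq_coe`, `exists_epsNorm_eq_coe_isEpsConj_out_of_isStablyEpsConjAt`, `mem_centralizer_of_epsNorm_eq_coe`, `isEpsNormPair_of_epsNorm_eq_coe`, `isEpsConj_mul_mul_epsLoc_inv_of_commute`), ★ p863295 CartanNormMap (`mul_comm_of_mem_centralizer_of_isRegularElt`), ★ C-TT `R90S4TwistedTransferDefs` (`stableEpsOrbitalIntegral_eq_finsum`, `isStablyEpsConjAt_of_isEpsNormPair`), ★ `Ch4Sec10` (`classEpsOrbitalIntegral`, `EpsConjClassesMod`)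
import HarnessLib

/-!
# R90-TF · S4 «Ch. 13.1–2», T-WIF road, head M4-b — NORM TRANSVERSALS: the sum of `Φ_ε(⟦t⟧, φ)` over the ε-classes of norm `γ` IS `Φ^{st}_ε(sec₀ γ, φ)`; (FIN) ⟺ a
# finite norm transversal; representatives of `K_T = T̃ᴺ ∕ (1−ε)T̃` translate any point of norm `γ` through one (Rogawski 1990, §12.5 p. 186; §4.10 (4.10.1) p. 57)

Cell `hodgecm-mathlib`, crux H413 (`stmt-HodgeConjecture-24833`, lane `--supports … --as helper`), route of record `HCCMUnconditional` (no route verbs;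
count-neutral).  Programme R90-TF, section S4 = [Rogawski1990] Ch. 13.1–13.2; seat R90-C131-p03 (g3); head M4 (NORM-PUSH) of the HEADS SHEETS
`R90/R90-C131-p03/g2/HEADS-TWIF-tube.md` §2 ∕ `HEADS-TWIF-tube.v2.md` §5′, FILE 1∕2 = the S4 half «(M4-b) the S4 instance with (FIN) as a NAMED hypothesis» (S4 dealer
K2E2-plan (g7), GO 2026-09-05T00:50:28Z); FILE 2∕2 `R90S4TwistedNormPush` = the generic finite-kernel push (M4-a) + the assembly form.  THEOREMS ONLY — no `def`, no
instance, no notation, no named-fact hypothesis, no `sorry`; ★-only imports (one S4 `Theorems` file of this lineage), never `Lines`.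

HONEST LABEL: HC_CM is proved only modulo the 7 printed citations (2 remaining named inputs: hLiu418 = stmt-HodgeConjecture-24832, h413 =
stmt-HodgeConjecture-24833) until rung 0 closes.  Finite sums and group algebra on `T̃`; discharges no socket by itself — the twisted tube Jacobian (J̃), «compatible
measures» (CMP′), the finiteness letters (FIN)∕(IDX) and (DICT)∕(WEYL-COUNT) are HYPOTHESES here or untouched (REL ≠ ★ ≠ BUILT).

## The mathematics

PRINT [Rogawski1990 §12.5 p. 186]: with `T̃ = Cent_{G̃}(T)`, `T̃ᴺ = {δ ∈ T̃ : N(δ) = 1}`, «the sequence `1 → Z̃T̃ᴺ → T̃ —N→ Z∖T → 1` is exact … `∫_{Z̃∖G̃} φ α dg =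
Σ_T |Ω_F(T,G)|⁻¹ ∫_{Z̃T̃ᴺ∖T̃} D_G(N(δ))² Φ^{st}_ε(δ, φ) α(δ) dδ`»; [§4.10 (4.10.1) p. 57] `Φ^{st}_ε(δ, φ) = Σ_{δ′} Φ_ε(δ′, φ)` over the ε-classes in the stable ε-class of `δ`.
The ε-twisted tube map of a Cartan (`Ψ_T (x, t) = x t ε(x)⁻¹`, ★ FILE β `R90S4TwistedTubeOrbitalBase`) produces the torus side with the SINGLE-CLASS integrand
`t ↦ Φ_ε(⟦t⟧, φ) β(t)`; print's integrand is the STABLE one, a function of the norm `γ = N(t)` alone.  Here, for hermitian `Φ`, `γ ∈ G_v` and `δ₀` with `γ ∈ 𝒩(δ₀)`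
(e.g. `δ₀ = sec₀ γ`), a NORM TRANSVERSAL over `γ` is a finite family `r_i ∈ G̃_v` with `N(r_i) = γ`, pairwise ε-inequivalent, meeting every ε-class of norm `γ`:
* §1 by ★ FILE α (`{c | IsStablyEpsConjAt … δ₀ (out c)} = ⟦·⟧ '' N⁻¹(γ)`) a norm transversal enumerates the index set of `Φ^{st}_ε(δ₀, ·)` bijectively; so (FIN) — p27's
  letter `{c | IsStablyEpsConjAt … δ₀ (out c)}.Finite`, a named hypothesis in its own shape — holds iff a norm transversal exists (§1–§2, with `#classes = #transversal`,
  representatives chosen INSIDE `N⁻¹(γ) ⊆ T̃`); and (§2.3) if `R ⊆ T̃ᴺ` is a transversal of `T̃ᴺ ∕ (1−ε)T̃` (the (IDX)∕(K-FIN) letter of ★ p863871 `R90S4EpsClassesOverNormFinite`, binders `hRT`∕`hRcov`∕`hRinj`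
  verbatim; `K_T = T̃ᴺ ∕ (1−ε)T̃` finite) then for EVERY `t₀ ∈ N⁻¹(γ)`, `γ` regular, `{t₀ r : r ∈ R}` is a norm transversal (★ p863871 counts the classes: `ncard = R.card`).
* §3 (M4-b) `Φ^{st}_ε(δ₀, φ) = Σ_i Φ_ε(⟦r_i⟧, φ)` for every norm transversal, and `Σ_i Φ_ε(⟦r_i⟧, φ) β(r_i) = Φ^{st}_ε(δ₀, φ) β(δ₀)` for an ε-stable class function `β`;
  in the `K_T`-orbit form `Σ_{r ∈ R} Φ_ε(⟦t₀ r⟧, φ) β(t₀ r) = Φ^{st}_ε(δ₀, φ) β(δ₀)` — the pointwise identity that turns the tube map's integrand into print's.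

[cite: Rogawski1990, §12.5 p. 186; §4.10 (4.10.1) p. 57; §3.11 Prop. 3.11.1 (a)–(c), Prop. 3.11.2 pp. 34–35]
-/

set_option autoImplicit false
-- the mandated namespace repeats the single-problem summit's segment (`HodgeConjecture.HodgeConjecture`)
set_option linter.dupNamespace false

noncomputable section

open MeasureTheory
open scoped NumberField Matrix MatrixGroups ENNReal

namespace Summit.HodgeConjecture.HodgeConjecture.R90.S4

open Literature.NumberTheory.Rogawski1990 Literature.NumberTheory.Rogawski1990.Ch4Sec10
open Literature.NumberTheory.Automorphic
open IsDedekindDomain NumberField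

/-! ## §1–§2 Norm transversals over `γ`, (FIN), and representatives of `K_T = T̃ᴺ ∕ (1−ε)T̃` (algebra, no measures) -/

section NormTransversal

variable {L : Type} [Field L] [NumberField L] [IsCMField L] {Φ : GL (Fin 3) L}
  {v : HeightOneSpectrum (𝓞 ↥(maximalRealSubfield L))}

/-! ### §1 Norm transversals read on ε-classes -/

/-- **The image of the norm fibre is the range of a norm transversal**: if `N(r_i) = γ` for all `i` and every `t` with `N t = γ` is ε-conjugate to some `r_i`,
then `⟦·⟧ '' {t | N t = γ} = range (⟦·⟧ ∘ r)` (★ FILE α `epsConjClassesMod_mk_eq_mk_iff`: equal classes = ε-conjugate). [cite: Rogawski1990, §3.11 Prop. 3.11.1 (c) p. 34; §12.5 p. 186] -/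
theorem image_normFibre_eq_range_of_normTransversal
    {γ : (UnitaryGroup.cmDatum L 3 (Φ : Matrix (Fin 3) (Fin 3) L)).Local v} {ι : Type*} (r : ι → GtLoc L v)
    (hrN : ∀ i, epsNorm (epsLoc L Φ v) (r i) = γ.val)
    (hrcov : ∀ t : GtLoc L v, epsNorm (epsLoc L Φ v) t = γ.val → ∃ i, IsEpsConj (epsLoc L Φ v) (r i) t) :
    Quotient.mk (Relation.EqvGen.setoid (epsConjModRel (epsLoc L Φ v) ⊥)) '' {t : GtLoc L v | epsNorm (epsLoc L Φ v) t = γ.val} =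
      Set.range fun i => (Quotient.mk (Relation.EqvGen.setoid (epsConjModRel (epsLoc L Φ v) ⊥)) (r i) : EpsConjClassesMod (epsLoc L Φ v) ⊥) := by
  ext c
  constructor
  · rintro ⟨t, ht, rfl⟩
    obtain ⟨i, hi⟩ := hrcov t ht
    exact ⟨i, (epsConjClassesMod_mk_eq_mk_iff (epsLoc L Φ v) _ _).2 hi⟩
  · rintro ⟨i, rfl⟩
    exact ⟨r i, hrN i, rfl⟩

/-- **A norm transversal is injective on classes**: pairwise ε-inequivalent `r_i` have pairwise distinct ε-classes. [cite: Rogawski1990, §3.11 p. 35] -/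
theorem injective_mk_comp_of_normTransversal {ι : Type*} (r : ι → GtLoc L v)
    (hrinj : ∀ i j, IsEpsConj (epsLoc L Φ v) (r i) (r j) → i = j) :
    Function.Injective fun i => (Quotient.mk (Relation.EqvGen.setoid (epsConjModRel (epsLoc L Φ v) ⊥)) (r i) : EpsConjClassesMod (epsLoc L Φ v) ⊥) :=
  fun i j h => hrinj i j ((epsConjClassesMod_mk_eq_mk_iff (epsLoc L Φ v) _ _).1 h)

/-- **Every element of norm exactly `γ ∈ 𝒩(δ₀)` is stably ε-conjugate to `δ₀`** (common norm `γ`; in particular every member of a norm transversal).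
[cite: Rogawski1990, §3.11 Prop. 3.11.1 (c) p. 34] -/
theorem isStablyEpsConjAt_of_epsNorm_eq_coe
    {γ : (UnitaryGroup.cmDatum L 3 (Φ : Matrix (Fin 3) (Fin 3) L)).Local v} {δ₀ : GtLoc L v} (hδ₀ : IsEpsNormPair L Φ v δ₀ γ)
    {t : GtLoc L v} (ht : epsNorm (epsLoc L Φ v) t = γ.val) : IsStablyEpsConjAt L Φ v t δ₀ :=
  isStablyEpsConjAt_of_isEpsNormPair (isEpsNormPair_of_epsNorm_eq_coe ht) hδ₀

/-- **A norm transversal computes the index set of `Φ^{st}_ε(δ₀, ·)`**: `{c | IsStablyEpsConjAt … δ₀ (out c)} = range (⟦·⟧ ∘ r)` (hermitian `Φ`, `γ ∈ 𝒩(δ₀)`; ★ FILE α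
`setOf_isStablyEpsConjAt_out_eq_image_normFibre` + §2.1). [cite: Rogawski1990, §3.11 Prop. 3.11.1 (c) p. 34; §4.10 (4.10.1) p. 57] -/
theorem setOf_isStablyEpsConjAt_out_eq_range_of_normTransversal
    (hΦ : ((Φ : GL (Fin 3) L) : Matrix (Fin 3) (Fin 3) L)ᵀ.map (IsCMField.complexConj L) = (Φ : Matrix (Fin 3) (Fin 3) L))
    {γ : (UnitaryGroup.cmDatum L 3 (Φ : Matrix (Fin 3) (Fin 3) L)).Local v} {δ₀ : GtLoc L v} (hδ₀ : IsEpsNormPair L Φ v δ₀ γ)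
    {ι : Type*} (r : ι → GtLoc L v) (hrN : ∀ i, epsNorm (epsLoc L Φ v) (r i) = γ.val)
    (hrcov : ∀ t : GtLoc L v, epsNorm (epsLoc L Φ v) t = γ.val → ∃ i, IsEpsConj (epsLoc L Φ v) (r i) t) :
    {c : EpsConjClassesMod (epsLoc L Φ v) ⊥ | IsStablyEpsConjAt L Φ v δ₀ (Quotient.out c)} =
      Set.range fun i => (Quotient.mk (Relation.EqvGen.setoid (epsConjModRel (epsLoc L Φ v) ⊥)) (r i) : EpsConjClassesMod (epsLoc L Φ v) ⊥) := by
  rw [setOf_isStablyEpsConjAt_out_eq_image_normFibre hΦ hδ₀, image_normFibre_eq_range_of_normTransversal r hrN hrcov]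

/-- **A FINITE norm transversal gives (FIN)**: the index set of `Φ^{st}_ε(δ₀, ·)` is finite. [cite: Rogawski1990, §3.11 Prop. 3.11.1 (c) p. 34; §12.5 p. 186] -/
theorem finite_setOf_isStablyEpsConjAt_out_of_normTransversal
    (hΦ : ((Φ : GL (Fin 3) L) : Matrix (Fin 3) (Fin 3) L)ᵀ.map (IsCMField.complexConj L) = (Φ : Matrix (Fin 3) (Fin 3) L))
    {γ : (UnitaryGroup.cmDatum L 3 (Φ : Matrix (Fin 3) (Fin 3) L)).Local v} {δ₀ : GtLoc L v} (hδ₀ : IsEpsNormPair L Φ v δ₀ γ)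
    {ι : Type*} [Finite ι] (r : ι → GtLoc L v) (hrN : ∀ i, epsNorm (epsLoc L Φ v) (r i) = γ.val)
    (hrcov : ∀ t : GtLoc L v, epsNorm (epsLoc L Φ v) t = γ.val → ∃ i, IsEpsConj (epsLoc L Φ v) (r i) t) :
    {c : EpsConjClassesMod (epsLoc L Φ v) ⊥ | IsStablyEpsConjAt L Φ v δ₀ (Quotient.out c)}.Finite := by
  rw [setOf_isStablyEpsConjAt_out_eq_range_of_normTransversal hΦ hδ₀ r hrN hrcov]
  exact Set.finite_range _

/-- **… and counts it: `#{ε-classes of norm γ} = |ι|`** for a norm transversal indexed by `ι` (injectivity on classes from pairwise ε-inequivalence).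
[cite: Rogawski1990, §3.11 Prop. 3.11.1 (c) p. 34; §12.5 p. 186] -/
theorem nat_card_setOf_isStablyEpsConjAt_out_of_normTransversal
    (hΦ : ((Φ : GL (Fin 3) L) : Matrix (Fin 3) (Fin 3) L)ᵀ.map (IsCMField.complexConj L) = (Φ : Matrix (Fin 3) (Fin 3) L))
    {γ : (UnitaryGroup.cmDatum L 3 (Φ : Matrix (Fin 3) (Fin 3) L)).Local v} {δ₀ : GtLoc L v} (hδ₀ : IsEpsNormPair L Φ v δ₀ γ)
    {ι : Type*} (r : ι → GtLoc L v) (hrN : ∀ i, epsNorm (epsLoc L Φ v) (r i) = γ.val)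
    (hrinj : ∀ i j, IsEpsConj (epsLoc L Φ v) (r i) (r j) → i = j)
    (hrcov : ∀ t : GtLoc L v, epsNorm (epsLoc L Φ v) t = γ.val → ∃ i, IsEpsConj (epsLoc L Φ v) (r i) t) :
    Nat.card ↥{c : EpsConjClassesMod (epsLoc L Φ v) ⊥ | IsStablyEpsConjAt L Φ v δ₀ (Quotient.out c)} = Nat.card ι := by
  rw [setOf_isStablyEpsConjAt_out_eq_range_of_normTransversal hΦ hδ₀ r hrN hrcov]
  exact Nat.card_range_of_injective (injective_mk_comp_of_normTransversal r hrinj)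

/-! ### §2 (FIN) ⇒ a norm transversal inside `N⁻¹(γ) ⊆ T̃` exists, with `#transversal = #classes` -/

/-- **(FIN) GIVES A NORM TRANSVERSAL** (hermitian `Φ`, `γ ∈ 𝒩(δ₀)`): if the index set `{c | IsStablyEpsConjAt … δ₀ (out c)}` of `Φ^{st}_ε(δ₀, ·)` is FINITE (the letter
(FIN), here a named hypothesis in its own shape), then there is a finite set `R ⊆ N⁻¹(γ) ⊆ T̃ = Cent(γ)` of pairwise ε-inequivalent elements meeting every ε-class of norm
`γ`, with `|R| =` the number of those classes — one representative OF NORM EXACTLY `γ` per class (★ FILE α `exists_epsNorm_eq_coe_isEpsConj_out_of_isStablyEpsConjAt`).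
[cite: Rogawski1990, §3.11 Prop. 3.11.1 (b)(c) pp. 34–35; §12.5 p. 186] -/
theorem exists_normTransversal_of_finite
    (hΦ : ((Φ : GL (Fin 3) L) : Matrix (Fin 3) (Fin 3) L)ᵀ.map (IsCMField.complexConj L) = (Φ : Matrix (Fin 3) (Fin 3) L))
    {γ : (UnitaryGroup.cmDatum L 3 (Φ : Matrix (Fin 3) (Fin 3) L)).Local v} {δ₀ : GtLoc L v} (hδ₀ : IsEpsNormPair L Φ v δ₀ γ)
    (hfin : {c : EpsConjClassesMod (epsLoc L Φ v) ⊥ | IsStablyEpsConjAt L Φ v δ₀ (Quotient.out c)}.Finite) :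
    ∃ R : Finset (GtLoc L v),
      (∀ t ∈ R, epsNorm (epsLoc L Φ v) t = γ.val) ∧
      (∀ t ∈ R, t ∈ Subgroup.centralizer ({(γ.val : GtLoc L v)} : Set (GtLoc L v))) ∧
      (∀ t ∈ R, ∀ t' ∈ R, IsEpsConj (epsLoc L Φ v) t t' → t = t') ∧
      (∀ t' : GtLoc L v, epsNorm (epsLoc L Φ v) t' = γ.val → ∃ t ∈ R, IsEpsConj (epsLoc L Φ v) t t') ∧
      R.card = Nat.card ↥{c : EpsConjClassesMod (epsLoc L Φ v) ⊥ | IsStablyEpsConjAt L Φ v δ₀ (Quotient.out c)} := by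
  classical
  -- one representative of norm exactly `γ` per class in the (finite) index set
  have hrep : ∀ c : ↥{c : EpsConjClassesMod (epsLoc L Φ v) ⊥ | IsStablyEpsConjAt L Φ v δ₀ (Quotient.out c)}, ∃ t : GtLoc L v,
      epsNorm (epsLoc L Φ v) t = γ.val ∧ t ∈ Subgroup.centralizer ({(γ.val : GtLoc L v)} : Set (GtLoc L v)) ∧
        Quotient.mk (Relation.EqvGen.setoid (epsConjModRel (epsLoc L Φ v) ⊥)) t = (c : EpsConjClassesMod (epsLoc L Φ v) ⊥) := fun c => by
    obtain ⟨t, hN, hT, -, hmk⟩ := exists_epsNorm_eq_coe_isEpsConj_out_of_isStablyEpsConjAt hΦ hδ₀ c.2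
    exact ⟨t, hN, hT, hmk⟩
  choose r hrN hrT hrmk using hrep
  haveI : Fintype ↥{c : EpsConjClassesMod (epsLoc L Φ v) ⊥ | IsStablyEpsConjAt L Φ v δ₀ (Quotient.out c)} := hfin.fintype
  have hrinj : Function.Injective r := fun c c' h => Subtype.ext (by rw [← hrmk c, ← hrmk c', h])
  refine ⟨Finset.univ.image r, ?_, ?_, ?_, ?_, ?_⟩
  · intro t ht
    obtain ⟨c, -, rfl⟩ := Finset.mem_image.1 ht
    exact hrN c
  · intro t ht
    obtain ⟨c, -, rfl⟩ := Finset.mem_image.1 ht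
    exact hrT c
  · intro t ht t' ht' hc
    obtain ⟨c, -, rfl⟩ := Finset.mem_image.1 ht
    obtain ⟨c', -, rfl⟩ := Finset.mem_image.1 ht'
    have hcc' : c = c' := by
      apply Subtype.ext
      have hqq := (epsConjClassesMod_mk_eq_mk_iff (epsLoc L Φ v) (r c) (r c')).2 hc
      rw [hrmk c, hrmk c'] at hqq
      exact hqq
    rw [hcc']
  · intro t' ht'
    have hc' : (Quotient.mk (Relation.EqvGen.setoid (epsConjModRel (epsLoc L Φ v) ⊥)) t' : EpsConjClassesMod (epsLoc L Φ v) ⊥) ∈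
        {c : EpsConjClassesMod (epsLoc L Φ v) ⊥ | IsStablyEpsConjAt L Φ v δ₀ (Quotient.out c)} := by
      rw [setOf_isStablyEpsConjAt_out_eq_image_normFibre hΦ hδ₀]
      exact ⟨t', ht', rfl⟩
    refine ⟨r ⟨_, hc'⟩, Finset.mem_image_of_mem _ (Finset.mem_univ _), ?_⟩
    exact (epsConjClassesMod_mk_eq_mk_iff (epsLoc L Φ v) _ _).1 (hrmk ⟨_, hc'⟩)
  · rw [Finset.card_image_of_injective _ hrinj, Finset.card_univ, Nat.card_eq_fintype_card]

/-! ### §2.3 A transversal `R` of `T̃ᴺ ∕ (1−ε)T̃` translates ANY point of norm `γ` (regular) through a norm transversal -/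

/-- **A TRANSVERSAL OF `K_T = T̃ᴺ ∕ (1−ε)T̃` TRANSLATES ANY POINT OF NORM `γ` THROUGH A NORM TRANSVERSAL.**  Let `Φ` be hermitian, `γ ∈ G_v` REGULAR, `T̃ = Cent(γ)`, and
`R ⊆ T̃ᴺ` finite with the three letters of ★ p863871 `ncard_setOf_isStablyEpsConjAt_eq_card` VERBATIM: `hRT` (`r ∈ T̃`, `N r = 1`), `hRcov` (every `u ∈ T̃ᴺ` is `r · s ε(s)⁻¹`,
`r ∈ R`, `s ∈ T̃`), `hRinj` (distinct members of `R` do not differ by an `s ε(s)⁻¹`) — `|R| = |K_T|`, the (IDX)∕(K-FIN) letter, a hypothesis here.  Then for EVERY `t₀` with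
`N t₀ = γ`, the translates `t₀ r` (`r ∈ R`) have norm `γ`, are pairwise ε-inequivalent, and meet every ε-class of norm `γ` (★ FILE α: the ε-classes over a regular `γ` are
the `(1−ε)T̃`-cosets of `N⁻¹(γ)`; ★ p863871 `epsNorm_eq_one_of_mem_normFibre`, `epsNorm_mul_eq_coe_of_epsNorm_eq_one`). [cite: Rogawski1990, §12.5 p. 186; §3.11 Prop. 3.11.1 (c), Prop. 3.11.2 pp. 34–35] -/
theorem normTransversal_mul_of_kernelRepresentatives
    (hΦ : ((Φ : GL (Fin 3) L) : Matrix (Fin 3) (Fin 3) L)ᵀ.map (IsCMField.complexConj L) = (Φ : Matrix (Fin 3) (Fin 3) L))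
    {γ : (UnitaryGroup.cmDatum L 3 (Φ : Matrix (Fin 3) (Fin 3) L)).Local v} (hγ : IsRegularElt (γ.val : GtLoc L v)) (R : Finset (GtLoc L v))
    (hRT : ∀ r ∈ R, r ∈ Subgroup.centralizer ({(γ.val : GtLoc L v)} : Set (GtLoc L v)) ∧ epsNorm (epsLoc L Φ v) r = 1)
    (hRcov : ∀ u ∈ Subgroup.centralizer ({(γ.val : GtLoc L v)} : Set (GtLoc L v)), epsNorm (epsLoc L Φ v) u = 1 →
      ∃ r ∈ R, ∃ s ∈ Subgroup.centralizer ({(γ.val : GtLoc L v)} : Set (GtLoc L v)), u = r * (s * (epsLoc L Φ v s)⁻¹))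
    (hRinj : ∀ r ∈ R, ∀ r' ∈ R, (∃ s ∈ Subgroup.centralizer ({(γ.val : GtLoc L v)} : Set (GtLoc L v)), r' = r * (s * (epsLoc L Φ v s)⁻¹)) → r = r')
    {t₀ : GtLoc L v} (ht₀ : epsNorm (epsLoc L Φ v) t₀ = γ.val) :
    (∀ r : ↥R, epsNorm (epsLoc L Φ v) (t₀ * (r : GtLoc L v)) = γ.val) ∧
      (∀ r r' : ↥R, IsEpsConj (epsLoc L Φ v) (t₀ * (r : GtLoc L v)) (t₀ * (r' : GtLoc L v)) → r = r') ∧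
      (∀ t' : GtLoc L v, epsNorm (epsLoc L Φ v) t' = γ.val → ∃ r : ↥R, IsEpsConj (epsLoc L Φ v) (t₀ * (r : GtLoc L v)) t') := by
  have ht₀T := mem_centralizer_of_epsNorm_eq_coe hΦ ht₀
  have hrN : ∀ r : ↥R, epsNorm (epsLoc L Φ v) (t₀ * (r : GtLoc L v)) = γ.val :=
    fun r => epsNorm_mul_eq_coe_of_epsNorm_eq_one hΦ hγ ht₀ (hRT r r.2).1 (hRT r r.2).2
  refine ⟨hrN, fun r r' h => ?_, fun t' ht' => ?_⟩
  · obtain ⟨s, hs, heq⟩ := (isEpsConj_iff_exists_mem_centralizer_of_epsNorm_eq_coe hΦ hγ (hrN r) (hrN r')).1 h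
    refine Subtype.ext (hRinj r r.2 r' r'.2 ⟨s, hs, ?_⟩)
    rw [mul_assoc] at heq
    exact mul_left_cancel heq
  · obtain ⟨hwT, hwN⟩ := epsNorm_eq_one_of_mem_normFibre hΦ hγ ht₀ ht'
    obtain ⟨r, hr, s, hs, hw⟩ := hRcov _ hwT hwN
    refine ⟨⟨r, hr⟩, ?_⟩
    have ht'eq : t' = t₀ * r * (s * (epsLoc L Φ v s)⁻¹) := by
      rw [mul_assoc, ← hw, mul_inv_cancel_left]
    rw [ht'eq]
    exact isEpsConj_mul_mul_epsLoc_inv_of_commute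
      (mul_comm_of_mem_centralizer_of_isRegularElt hγ hs (Subgroup.mul_mem _ ht₀T (hRT r hr).1))

end NormTransversal

/-! ## §3 (M4-b) The sum of `Φ_ε(⟦t⟧, φ)` over the ε-classes of norm `γ` IS `Φ^{st}_ε(δ₀, φ)` -/

section NormFibreSum

variable {L : Type} [Field L] [NumberField L] [IsCMField L] {Φ : GL (Fin 3) L}
  {v : HeightOneSpectrum (𝓞 ↥(maximalRealSubfield L))}
  [∀ δ : GtLoc L v, MeasurableSpace (GtLoc L v ⧸ epsCentralizer (epsLoc L Φ v) δ)]

/-- **`Φ^{st}_ε(δ₀, φ) = Σ_{c ∈ ⟦·⟧ '' N⁻¹(γ)} Φ_ε(c, φ)`** for hermitian `Φ` and any `γ ∈ 𝒩(δ₀)`: the `finsum` of ★ `stableEpsOrbitalIntegral_eq_finsum` runs over the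
image of the norm fibre `{t | N t = γ}` (★ FILE α `setOf_isStablyEpsConjAt_out_eq_image_normFibre`). [cite: Rogawski1990, §4.10 (4.10.1) p. 57; §12.5 p. 186] -/
theorem stableEpsOrbitalIntegral_eq_finsum_mem_image_normFibre
    (hΦ : ((Φ : GL (Fin 3) L) : Matrix (Fin 3) (Fin 3) L)ᵀ.map (IsCMField.complexConj L) = (Φ : Matrix (Fin 3) (Fin 3) L))
    {γ : (UnitaryGroup.cmDatum L 3 (Φ : Matrix (Fin 3) (Fin 3) L)).Local v} {δ₀ : GtLoc L v} (hδ₀ : IsEpsNormPair L Φ v δ₀ γ)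
    (mGt : EpsOrbitalMeasureFamily (epsLoc L Φ v) ⊥) (φ : GtLoc L v → ℂ) :
    stableEpsOrbitalIntegral L Φ v mGt φ δ₀ =
      ∑ᶠ c ∈ Quotient.mk (Relation.EqvGen.setoid (epsConjModRel (epsLoc L Φ v) ⊥)) '' {t : GtLoc L v | epsNorm (epsLoc L Φ v) t = γ.val},
        classEpsOrbitalIntegral (epsLoc L Φ v) mGt φ c := by
  rw [stableEpsOrbitalIntegral_eq_finsum, setOf_isStablyEpsConjAt_out_eq_image_normFibre hΦ hδ₀]
  rfl

/-- **(M4-b) THE NORM FIBRE SUM — `Φ^{st}_ε(δ₀, φ) = Σ_i Φ_ε(⟦r_i⟧, φ)` FOR EVERY NORM TRANSVERSAL OVER `γ ∈ 𝒩(δ₀)`** (hermitian `Φ`): `r : ι → G̃_v` finite with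
(i) `N(r_i) = γ`, (ii) `r_i ∼_ε r_j ⇒ i = j`, (iii) every `t` with `N t = γ` is ε-conjugate to some `r_i`.  The stable ε-orbital integral — a `finsum` over the ε-classes of
norm `γ` — becomes an honest finite sum over the transversal. [cite: Rogawski1990, §4.10 (4.10.1) p. 57; §12.5 p. 186; §3.11 Prop. 3.11.1 (c) pp. 34–35] -/
theorem stableEpsOrbitalIntegral_eq_sum_of_normTransversal
    (hΦ : ((Φ : GL (Fin 3) L) : Matrix (Fin 3) (Fin 3) L)ᵀ.map (IsCMField.complexConj L) = (Φ : Matrix (Fin 3) (Fin 3) L))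
    {γ : (UnitaryGroup.cmDatum L 3 (Φ : Matrix (Fin 3) (Fin 3) L)).Local v} {δ₀ : GtLoc L v} (hδ₀ : IsEpsNormPair L Φ v δ₀ γ)
    (mGt : EpsOrbitalMeasureFamily (epsLoc L Φ v) ⊥) (φ : GtLoc L v → ℂ)
    {ι : Type*} [Fintype ι] (r : ι → GtLoc L v)
    (hrN : ∀ i, epsNorm (epsLoc L Φ v) (r i) = γ.val)
    (hrinj : ∀ i j, IsEpsConj (epsLoc L Φ v) (r i) (r j) → i = j)
    (hrcov : ∀ t : GtLoc L v, epsNorm (epsLoc L Φ v) t = γ.val → ∃ i, IsEpsConj (epsLoc L Φ v) (r i) t) :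
    stableEpsOrbitalIntegral L Φ v mGt φ δ₀ =
      ∑ i, classEpsOrbitalIntegral (epsLoc L Φ v) mGt φ (Quotient.mk (Relation.EqvGen.setoid (epsConjModRel (epsLoc L Φ v) ⊥)) (r i)) := by
  rw [stableEpsOrbitalIntegral_eq_finsum_mem_image_normFibre hΦ hδ₀, image_normFibre_eq_range_of_normTransversal r hrN hrcov,
    finsum_mem_range (injective_mk_comp_of_normTransversal r hrinj), finsum_eq_sum_of_fintype]

/-- **(M4-b) WITH AN ε-STABLE CLASS FUNCTION — `Σ_i Φ_ε(⟦r_i⟧, φ) β(r_i) = Φ^{st}_ε(δ₀, φ) β(δ₀)`**: for `β` constant on stable ε-classes (the `β` of ★ `IsTwistedWeylMeasure`)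
and a norm transversal `r` over `γ ∈ 𝒩(δ₀)`, `β(r_i) = β(δ₀)` for all `i` (common norm) and the classes sum to `Φ^{st}_ε`.  This is the pointwise identity that turns
the single-class torus integrand `Φ_ε(⟦t⟧, φ) β(t)` of the tube map into print's `Φ^{st}_ε(δ, φ) α(δ)`. [cite: Rogawski1990, §12.5 p. 186; §4.10 (4.10.1) p. 57] -/
theorem sum_classEpsOrbitalIntegral_mul_eq_stableEpsOrbitalIntegral_mul_of_normTransversal
    (hΦ : ((Φ : GL (Fin 3) L) : Matrix (Fin 3) (Fin 3) L)ᵀ.map (IsCMField.complexConj L) = (Φ : Matrix (Fin 3) (Fin 3) L))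
    {γ : (UnitaryGroup.cmDatum L 3 (Φ : Matrix (Fin 3) (Fin 3) L)).Local v} {δ₀ : GtLoc L v} (hδ₀ : IsEpsNormPair L Φ v δ₀ γ)
    (mGt : EpsOrbitalMeasureFamily (epsLoc L Φ v) ⊥) (φ : GtLoc L v → ℂ)
    {ι : Type*} [Fintype ι] (r : ι → GtLoc L v)
    (hrN : ∀ i, epsNorm (epsLoc L Φ v) (r i) = γ.val)
    (hrinj : ∀ i j, IsEpsConj (epsLoc L Φ v) (r i) (r j) → i = j)
    (hrcov : ∀ t : GtLoc L v, epsNorm (epsLoc L Φ v) t = γ.val → ∃ i, IsEpsConj (epsLoc L Φ v) (r i) t)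
    (β : GtLoc L v → ℂ) (hβ : ∀ δ δ' : GtLoc L v, IsStablyEpsConjAt L Φ v δ δ' → β δ = β δ') :
    ∑ i, classEpsOrbitalIntegral (epsLoc L Φ v) mGt φ (Quotient.mk (Relation.EqvGen.setoid (epsConjModRel (epsLoc L Φ v) ⊥)) (r i)) * β (r i) =
      stableEpsOrbitalIntegral L Φ v mGt φ δ₀ * β δ₀ := by
  have hβi : ∀ i ∈ (Finset.univ : Finset ι), classEpsOrbitalIntegral (epsLoc L Φ v) mGt φ
        (Quotient.mk (Relation.EqvGen.setoid (epsConjModRel (epsLoc L Φ v) ⊥)) (r i)) * β (r i) =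
      classEpsOrbitalIntegral (epsLoc L Φ v) mGt φ (Quotient.mk (Relation.EqvGen.setoid (epsConjModRel (epsLoc L Φ v) ⊥)) (r i)) * β δ₀ :=
    fun i _ => by rw [hβ _ _ (isStablyEpsConjAt_of_epsNorm_eq_coe hδ₀ (hrN i))]
  rw [Finset.sum_congr rfl hβi, ← Finset.sum_mul, ← stableEpsOrbitalIntegral_eq_sum_of_normTransversal hΦ hδ₀ mGt φ r hrN hrinj hrcov]

/-- **`Finset` form**: for a finite SET `R ⊆ G̃_v` of pairwise ε-inequivalent elements of norm `γ` meeting every ε-class of norm `γ` (e.g. the `R` of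
`exists_normTransversal_of_finite`), `Φ^{st}_ε(δ₀, φ) = Σ_{t ∈ R} Φ_ε(⟦t⟧, φ)`. [cite: Rogawski1990, §4.10 (4.10.1) p. 57; §12.5 p. 186] -/
theorem stableEpsOrbitalIntegral_eq_finset_sum_of_normTransversal
    (hΦ : ((Φ : GL (Fin 3) L) : Matrix (Fin 3) (Fin 3) L)ᵀ.map (IsCMField.complexConj L) = (Φ : Matrix (Fin 3) (Fin 3) L))
    {γ : (UnitaryGroup.cmDatum L 3 (Φ : Matrix (Fin 3) (Fin 3) L)).Local v} {δ₀ : GtLoc L v} (hδ₀ : IsEpsNormPair L Φ v δ₀ γ)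
    (mGt : EpsOrbitalMeasureFamily (epsLoc L Φ v) ⊥) (φ : GtLoc L v → ℂ) (R : Finset (GtLoc L v))
    (hRN : ∀ t ∈ R, epsNorm (epsLoc L Φ v) t = γ.val)
    (hRinj : ∀ t ∈ R, ∀ t' ∈ R, IsEpsConj (epsLoc L Φ v) t t' → t = t')
    (hRcov : ∀ t' : GtLoc L v, epsNorm (epsLoc L Φ v) t' = γ.val → ∃ t ∈ R, IsEpsConj (epsLoc L Φ v) t t') :
    stableEpsOrbitalIntegral L Φ v mGt φ δ₀ =
      ∑ t ∈ R, classEpsOrbitalIntegral (epsLoc L Φ v) mGt φ (Quotient.mk (Relation.EqvGen.setoid (epsConjModRel (epsLoc L Φ v) ⊥)) t) := by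
  rw [stableEpsOrbitalIntegral_eq_sum_of_normTransversal hΦ hδ₀ mGt φ (fun t : ↥R => (t : GtLoc L v)) (fun t => hRN t t.2)
    (fun t t' h => Subtype.ext (hRinj t t.2 t' t'.2 h)) (fun t' ht' => ?_)]
  · exact Finset.sum_coe_sort R fun t => classEpsOrbitalIntegral (epsLoc L Φ v) mGt φ
      (Quotient.mk (Relation.EqvGen.setoid (epsConjModRel (epsLoc L Φ v) ⊥)) t)
  · obtain ⟨t, ht, htt'⟩ := hRcov t' ht'
    exact ⟨⟨t, ht⟩, htt'⟩

/-- **(M4-b), `K_T`-ORBIT FORM — `Φ^{st}_ε(δ₀, φ) = Σ_{r ∈ R} Φ_ε(⟦t₀ r⟧, φ)`** for a transversal `R ⊆ T̃ᴺ` of `T̃ᴺ ∕ (1−ε)T̃` (§2.3, the binders `hRT`∕`hRcov`∕`hRinj` of ★ p863871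
`ncard_setOf_isStablyEpsConjAt_eq_card` verbatim), `γ` regular, ANY `t₀` with `N t₀ = γ` and ANY `δ₀` with `γ ∈ 𝒩(δ₀)`: the sum over the `K_T`-orbit of `t₀ · (1−ε)T̃` in
`T̃ ⧸ (1−ε)T̃` of the single-class integrand is the stable ε-orbital integral (★ p863871 counts the same set: `ncard = R.card`).
[cite: Rogawski1990, §12.5 p. 186; §4.10 (4.10.1) p. 57; §3.11 Prop. 3.11.1 (c), Prop. 3.11.2 pp. 34–35] -/
theorem stableEpsOrbitalIntegral_eq_sum_mul_of_kernelRepresentatives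
    (hΦ : ((Φ : GL (Fin 3) L) : Matrix (Fin 3) (Fin 3) L)ᵀ.map (IsCMField.complexConj L) = (Φ : Matrix (Fin 3) (Fin 3) L))
    {γ : (UnitaryGroup.cmDatum L 3 (Φ : Matrix (Fin 3) (Fin 3) L)).Local v} (hγ : IsRegularElt (γ.val : GtLoc L v))
    {δ₀ : GtLoc L v} (hδ₀ : IsEpsNormPair L Φ v δ₀ γ)
    (mGt : EpsOrbitalMeasureFamily (epsLoc L Φ v) ⊥) (φ : GtLoc L v → ℂ) (R : Finset (GtLoc L v))
    (hRT : ∀ r ∈ R, r ∈ Subgroup.centralizer ({(γ.val : GtLoc L v)} : Set (GtLoc L v)) ∧ epsNorm (epsLoc L Φ v) r = 1)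
    (hRcov : ∀ u ∈ Subgroup.centralizer ({(γ.val : GtLoc L v)} : Set (GtLoc L v)), epsNorm (epsLoc L Φ v) u = 1 →
      ∃ r ∈ R, ∃ s ∈ Subgroup.centralizer ({(γ.val : GtLoc L v)} : Set (GtLoc L v)), u = r * (s * (epsLoc L Φ v s)⁻¹))
    (hRinj : ∀ r ∈ R, ∀ r' ∈ R, (∃ s ∈ Subgroup.centralizer ({(γ.val : GtLoc L v)} : Set (GtLoc L v)), r' = r * (s * (epsLoc L Φ v s)⁻¹)) → r = r')
    {t₀ : GtLoc L v} (ht₀ : epsNorm (epsLoc L Φ v) t₀ = γ.val) :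
    stableEpsOrbitalIntegral L Φ v mGt φ δ₀ =
      ∑ r ∈ R, classEpsOrbitalIntegral (epsLoc L Φ v) mGt φ (Quotient.mk (Relation.EqvGen.setoid (epsConjModRel (epsLoc L Φ v) ⊥)) (t₀ * r)) := by
  obtain ⟨hrN, hrinj, hrcov⟩ := normTransversal_mul_of_kernelRepresentatives hΦ hγ R hRT hRcov hRinj ht₀
  rw [stableEpsOrbitalIntegral_eq_sum_of_normTransversal hΦ hδ₀ mGt φ (fun r : ↥R => t₀ * (r : GtLoc L v)) hrN hrinj hrcov]
  exact Finset.sum_coe_sort R fun r => classEpsOrbitalIntegral (epsLoc L Φ v) mGt φ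
    (Quotient.mk (Relation.EqvGen.setoid (epsConjModRel (epsLoc L Φ v) ⊥)) (t₀ * r))

/-- **`K_T`-orbit form with an ε-stable class function**: under the same hypotheses, `Σ_{r ∈ R} Φ_ε(⟦t₀ r⟧, φ) β(t₀ r) = Φ^{st}_ε(δ₀, φ) β(δ₀)`.
[cite: Rogawski1990, §12.5 p. 186; §4.10 (4.10.1) p. 57] -/
theorem sum_classEpsOrbitalIntegral_mul_eq_of_kernelRepresentatives
    (hΦ : ((Φ : GL (Fin 3) L) : Matrix (Fin 3) (Fin 3) L)ᵀ.map (IsCMField.complexConj L) = (Φ : Matrix (Fin 3) (Fin 3) L))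
    {γ : (UnitaryGroup.cmDatum L 3 (Φ : Matrix (Fin 3) (Fin 3) L)).Local v} (hγ : IsRegularElt (γ.val : GtLoc L v))
    {δ₀ : GtLoc L v} (hδ₀ : IsEpsNormPair L Φ v δ₀ γ)
    (mGt : EpsOrbitalMeasureFamily (epsLoc L Φ v) ⊥) (φ : GtLoc L v → ℂ) (R : Finset (GtLoc L v))
    (hRT : ∀ r ∈ R, r ∈ Subgroup.centralizer ({(γ.val : GtLoc L v)} : Set (GtLoc L v)) ∧ epsNorm (epsLoc L Φ v) r = 1)
    (hRcov : ∀ u ∈ Subgroup.centralizer ({(γ.val : GtLoc L v)} : Set (GtLoc L v)), epsNorm (epsLoc L Φ v) u = 1 →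
      ∃ r ∈ R, ∃ s ∈ Subgroup.centralizer ({(γ.val : GtLoc L v)} : Set (GtLoc L v)), u = r * (s * (epsLoc L Φ v s)⁻¹))
    (hRinj : ∀ r ∈ R, ∀ r' ∈ R, (∃ s ∈ Subgroup.centralizer ({(γ.val : GtLoc L v)} : Set (GtLoc L v)), r' = r * (s * (epsLoc L Φ v s)⁻¹)) → r = r')
    {t₀ : GtLoc L v} (ht₀ : epsNorm (epsLoc L Φ v) t₀ = γ.val)
    (β : GtLoc L v → ℂ) (hβ : ∀ δ δ' : GtLoc L v, IsStablyEpsConjAt L Φ v δ δ' → β δ = β δ') :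
    ∑ r ∈ R, classEpsOrbitalIntegral (epsLoc L Φ v) mGt φ (Quotient.mk (Relation.EqvGen.setoid (epsConjModRel (epsLoc L Φ v) ⊥)) (t₀ * r)) * β (t₀ * r) =
      stableEpsOrbitalIntegral L Φ v mGt φ δ₀ * β δ₀ := by
  have hβr : ∀ r ∈ R, classEpsOrbitalIntegral (epsLoc L Φ v) mGt φ
        (Quotient.mk (Relation.EqvGen.setoid (epsConjModRel (epsLoc L Φ v) ⊥)) (t₀ * r)) * β (t₀ * r) =
      classEpsOrbitalIntegral (epsLoc L Φ v) mGt φ (Quotient.mk (Relation.EqvGen.setoid (epsConjModRel (epsLoc L Φ v) ⊥)) (t₀ * r)) * β δ₀ :=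
    fun r hr => by rw [hβ _ _ (isStablyEpsConjAt_of_epsNorm_eq_coe hδ₀ (epsNorm_mul_eq_coe_of_epsNorm_eq_one hΦ hγ ht₀ (hRT r hr).1 (hRT r hr).2))]
  rw [Finset.sum_congr rfl hβr, ← Finset.sum_mul,
    ← stableEpsOrbitalIntegral_eq_sum_mul_of_kernelRepresentatives hΦ hγ hδ₀ mGt φ R hRT hRcov hRinj ht₀]

end NormFibreSum

end Summit.HodgeConjecture.HodgeConjecture.R90.S4

end
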